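import Literature.MathematicalPhysics.QuantumFieldTheory.BalabanImbrieJaffe1984to88.BIJ88Extraction311
import Literature.MathematicalPhysics.QuantumFieldTheory.BalabanImbrieJaffe1984to88.BIJ88IbpResult312

/-!
# `BalabanImbrieJaffe1984to88.BIJ88Eq5145Structural` — T. Bałaban, J. Imbrie, A. Jaffe, *Effective action and cluster properties of the abelian
Higgs model*, Commun. Math. Phys. **114** (1988) 257–315 [BalabanImbrieJaffe1988]: Sect. 5.14, p. 312 [PDF 56], **(5.14.5) WITH BOTH
*"without going into details"* STEPS REPLACED BY THEIR PRINTED STRUCTURE** (row `C2.Eq5.14.5`): p25 gen 7's assembled `BIJ88Result5145.eq5145`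
carried two displayed hypotheses by assertion — `h311` (p. 311 *"Altogether we have written V^{(k)}_{const}(Λ₈^{(k)}) + 𝒫̃_{k+1}(Λ₁₂^{(k)}) =
𝒫^L_{k+1,loc}(Λ₈^{(k)}) + Σ_X W₆^{(k)″}(X)"*) and `h312` (p. 312 *"⟨Π_{σ₁}F^{m̄}_{k,loc}(X_{σ₁})⟩₁ = Σ_{{X_{r′}}} Π_{r′}G_k(X_{r′}) Π_c F^L_{k+1,loc}(X_c)"*).
p31 gen 12's `BIJ88Extraction311.eq5145_of_extraction` discharges `h311` by the printed extraction recipe (diagram terms multilinear in the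
propagators, every propagator = standard covariance + localized pieces, `𝒫^L`/`W₆″` DEFINED); this seat's `BIJ88IbpResult312`
(`expect1_eq_sum_prod_Gk_mul_prod_FL`) discharges `h312` by the printed integration-by-parts structure plus a cluster expansion of each
remainder expectation. THIS FILE KNITS THE TWO: **`eq5145_structural`** — (5.14.5) with NEITHER `h311` NOR `h312` among its hypotheses.

HONEST FRAMING (cell `lit-balaban`, verbatim): statement-level skeleton of published theorems with citation tags; proofs where landed; nothing here is a claim about the Yang–Mills mass gap.

PDF held: `paper:balaban1988-cmp114-bij-abelian-higgs-effective-action` (journal page = PDF page + 256); p. 312 = PDF 56, read this session.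

**(5.14.5)** p. 312 [PDF 56], verbatim: *"To summarize the results of this section, we have e^{−V^{(k)}_{const}(Λ₈^{(k)})} Σ_{{X_α}} Π_α g₂(X_α) =
Σ_{{X_α} overlapping Λ₁₁^{(k)c}} Π_α g₂(X_α) Σ_{{X_{r′}}} Π_{r′} G_k(X_{r′}) × Π_{c: X_c⊄∪_{r′}X_{r′}} F^L_{k+1,loc}(X_c) exp(−𝒫^L_{k+1,loc}(Λ₈^{(k)}) − Σ_X
W₆^{(k)}(X)). (5.14.5)"*

**What is proved (0 `sorry`, standard axioms, 0 new `Prop` facts, one theorem).** `eq5145_structural`: the hypotheses are exactly those of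
`BIJ88Extraction311.eq5145_of_extraction` MINUS `h312`, PLUS — for every large-field-free region `W′` — the printed IBP structure of the observable
`F W′` (`hIBP`: remainder data `R W′`, constant components `CC W′` with diagrams `Dg W′` of constant values `v W′`, remainder terms `RT W′`/`u W′`;
`BIJ88IbpResult312.ibp_result`) and a cluster expansion of each remainder expectation (`hgas`: `⟨F_rem ρ⟩₁ = Σ_{φ∈Fam W′ ρ} Π_{X∈φ} G_k W′ X`, which
for the (5.14.3)-type gas is p25 gens 11–12 by name); the conclusion is (5.14.5) with the observable factor in the printed two-product form
`Σ_{(ρ,φ)} (Π_{X∈φ} G_k X)·Π_{c∈CC ρ} F^L(X_c)`, `𝒫^L := BIJ88Extraction311.PL`, `W₆″ := BIJ88Extraction311.W6pp`, `𝒳 := A.powerset`.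
REMAINING displayed inputs (all structural or on their own rows): (5.14.1) data `hYs`/`hg`/`hdec`; `hz` (z > 0); `hlogz` (the (5.14.2) split for
p31's `pert`); `hrem` (ℛ_k = Σ W₆′, p25 gen 6/12 by name for the model of record); the piece regions `hreg`; `hIBP`; `hgas`. Imports
`BIJ88Extraction311` (p31 g12) and `BIJ88IbpResult312` (p25 g13); modifies nothing. NOT summit progress; NOT continuum; NOT Clay. Cell
`lit-balaban` Phase 2, seat p25 gen 13 (row owner r16, referee ref-5).
-/

noncomputable section

open Finset
open Literature.Probability.LatticeModels (setPartitions)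
open Literature.MathematicalPhysics.QuantumFieldTheory.BalabanImbrieJaffe1984to88.BIJ88Resummation5141 (outer lam12 lam12_subset polysIn Compat
  restrictTo g2 zF zS)
open Literature.MathematicalPhysics.QuantumFieldTheory.BalabanImbrieJaffe1984to88.BIJ88Result5145 (expect1)
open Literature.MathematicalPhysics.QuantumFieldTheory.BalabanImbrieJaffe1984to88.BIJ88Extraction311 (pert PL W6pp eq5145_of_extraction)
open Literature.MathematicalPhysics.QuantumFieldTheory.BalabanImbrieJaffe1984to88.BIJ88IbpResult312 (expect1_eq_sum_prod_Gk_mul_prod_FL)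

namespace Literature.MathematicalPhysics.QuantumFieldTheory.BalabanImbrieJaffe1984to88.BIJ88Eq5145Structural

variable {ι : Type} [DecidableEq ι]
variable {S : Type*} {K : Type*} [AddCommGroup K] [Module ℝ K]
variable {D : Type*} [Fintype D] {P : Type*} [DecidableEq P]
variable {Φ : Type*} {Pr γ δ τ Xt : Type*} [DecidableEq γ]
variable (m : D → ℕ) (spec : (γ : D) → Fin (m γ) → S) (T : (γ : D) → ι → MultilinearMap ℝ (fun _ : Fin (m γ) => K) ℝ)
variable (Cstd : S → K) (pc : Finset ι → S → Finset P) (E : Finset ι → S → P → K) (reg : P → Finset ι) (ord : D → ℕ) (nbar : ℕ)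

/-- **(5.14.5) WITH BOTH *"without going into details"* STEPS REPLACED BY THEIR PRINTED STRUCTURE**: p31's `eq5145_of_extraction` (`h311`
discharged: `𝒫^L := PL`, `W₆″ := W6pp`, `𝒳 := A.powerset`) with its remaining `h312` FED from the printed integration-by-parts structure of the
observable of each region and a cluster expansion of each remainder expectation (`BIJ88IbpResult312.expect1_eq_sum_prod_Gk_mul_prod_FL`): the
observable factor of (5.14.5) is the printed `Σ_{{X_{r′}}} Π_{r′} G_k(X_{r′}) Π_{c: X_c⊄∪X_{r′}} F^L_{k+1,loc}(X_c)` read as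
`Σ_{(ρ,φ)} (Π_{X∈φ} G_k X)·Π_{c∈CC ρ} (Σ_{d∈Dg c} v c d)`. [cite: BalabanImbrieJaffe1988, (5.14.5) p.312] -/
theorem eq5145_structural (W B : Finset ι) (g : Finset ι → ℝ) (Ex : Finset ι → (Φ → ℝ) →ₗ[ℝ] ℝ) (χ F : Finset ι → Φ → ℝ)
    (Ys : Finset (Finset ι)) (b : Finset ι → Φ → ℝ) (g₁ : Finset ι → Finset (Finset ι) → ℝ)
    (hYs : ∀ Y ∈ Ys, Y.Nonempty) (hg : ∀ X ⊆ W, X.Nonempty → Disjoint X B → g X = g2 Ys g₁ X)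
    (hdec : ∀ W' ⊆ W, Disjoint W' B → ∀ S' ⊆ polysIn Ys W',
      zS Ex (fun W => χ W * F W) b W' S' = ∑ κ ∈ setPartitions W', if Compat κ S' then ∏ X ∈ κ, g₁ X (restrictTo S' X) else 0)
    (Vconst : ℝ) (A : Finset ι) (hWA : W ⊆ A) (hreg : ∀ W' s, ∀ r ∈ pc W' s, reg r ⊆ A)
    (rem : Finset ι → ℝ) (W6p : Finset ι → Finset ι → ℝ)
    (hz : ∀ W' ⊆ W, Disjoint W' B → 0 < zF Ex χ Ys b W')
    (hlogz : ∀ W' ⊆ W, Disjoint W' B → Real.log (zF Ex χ Ys b W') = -pert m spec T Cstd (pc W') (E W') W' - rem W')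
    (hrem : ∀ W' ⊆ W, Disjoint W' B → rem W' = ∑ X ∈ A.powerset, W6p W' X)
    -- the printed IBP structure of the observable of each region and the cluster expansion of each remainder expectation, replacing `h312`
    (R : Finset ι → Finset Pr) (CC : Finset ι → Pr → Finset γ) (Dg : Finset ι → γ → Finset δ) (v : Finset ι → γ → δ → ℝ)
    (RT : Finset ι → Pr → Finset τ) (u : Finset ι → Pr → τ → Φ → ℝ)
    (hIBP : ∀ W' ⊆ W, Disjoint W' B → F W' = ∑ ρ ∈ R W', ∑ t ∈ RT W' ρ, ∑ p ∈ (CC W' ρ).pi (fun c => Dg W' c),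
      (∏ x ∈ (CC W' ρ).attach, v W' x.1 (p x.1 x.2)) • u W' ρ t)
    (Fam : Finset ι → Pr → Finset (Finset Xt)) (Gk : Finset ι → Xt → ℝ)
    (hgas : ∀ W' ⊆ W, Disjoint W' B → ∀ ρ ∈ R W',
      expect1 Ex χ Ys b W' (∑ t ∈ RT W' ρ, u W' ρ t) = ∑ φ ∈ Fam W' ρ, ∏ X ∈ φ, Gk W' X) :
    Real.exp (-Vconst) * ∑ π ∈ setPartitions W, ∏ X ∈ π, g X =
      ∑ ρ ∈ outer W B, (∏ X ∈ ρ, g X) *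
        ((∑ x ∈ (R (lam12 W ρ)).sigma (Fam (lam12 W ρ)),
            (∏ X ∈ x.2, Gk (lam12 W ρ) X) * ∏ c ∈ CC (lam12 W ρ) x.1, ∑ d ∈ Dg (lam12 W ρ) c, v (lam12 W ρ) c d) *
          Real.exp (-PL m spec T Cstd ord nbar Vconst A
            - ∑ X ∈ A.powerset, (W6p (lam12 W ρ) X
                + W6pp m spec T Cstd (pc (lam12 W ρ)) (E (lam12 W ρ)) reg ord nbar A (lam12 W ρ) X))) :=
  eq5145_of_extraction m spec T Cstd pc E reg ord nbar W B g Ex χ F Ys b g₁ hYs hg hdec Vconst A hWA hreg rem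
    (fun W' => ∑ x ∈ (R W').sigma (Fam W'), (∏ X ∈ x.2, Gk W' X) * ∏ c ∈ CC W' x.1, ∑ d ∈ Dg W' c, v W' c d) W6p hz hlogz hrem
    fun W' hW' hdis => expect1_eq_sum_prod_Gk_mul_prod_FL Ex χ Ys b W' (R W') (CC W') (Dg W') (v W') (RT W') (u W') (hIBP W' hW' hdis)
      (Fam W') (Gk W') (hgas W' hW' hdis)

end Literature.MathematicalPhysics.QuantumFieldTheory.BalabanImbrieJaffe1984to88.BIJ88Eq5145Structural

end
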